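import Mathlib
import Summits.Ventures.PercRepro2.SwOutAll
import Summits.Ventures.PercRepro2.SwOutArmFlip

/-!
# The split at a set of junctions (blind cell PercRepro2, night-4 g11, 2026-08-25;
proofs/NIGHT4-G11.md §5(3))

The split graph `splitEndsS ends S` at a SET `S` of vertices: every endpoint in `S` of an edge `e`
is replaced by the private copy `Sum.inr e` (vertex type `V ⊕ E`).  For `S` INDEPENDENT (no edge
joins two vertices of `S`, no loop at `S`) every edge at `S` has exactly one end in `S` and the
split re-attaches it from that end to its copy — the split of `SwOutJunctionSplit` at every vertex
of `S` at once.  Connectivity transfers as for one vertex: `cluster_splitS_subset` (split → graph),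
`conn_splitS_of_conn` (graph → split, away from `S`), `inr_mem_cluster_splitS_iff` (copies).
-/

namespace Summit.Ventures.PercRepro2

namespace LocRows

open Hull

variable {V : Type*} {E : Type*} [Fintype E] [DecidableEq E]

open scoped Classical

section SplitS

variable (ends : E → Sym2 V) (S : Set V)

/-- The split graph at the set `S`: every endpoint in `S` of the edge `e` becomes the copy
`Sum.inr e`. -/
noncomputable def splitEndsS : E → Sym2 (V ⊕ E) :=
  fun e => (ends e).map fun x => if x ∈ S then Sum.inr e else Sum.inl x

/-- `S` is INDEPENDENT: no edge joins two vertices of `S` (no loop at `S` either). -/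
def IndepSet : Prop := ∀ e, ∀ x ∈ S, ∀ y ∈ S, ends e ≠ s(x, y)

variable {ends S}

omit [Fintype E] [DecidableEq E] in
/-- `inl x` is an endpoint of the split edge `e` iff `x ∉ S` is an endpoint of `e`. -/
lemma inl_mem_splitEndsS_iff {e : E} {x : V} :
    Sum.inl x ∈ splitEndsS ends S e ↔ x ∈ ends e ∧ x ∉ S := by
  simp only [splitEndsS, Sym2.mem_map]
  constructor
  · rintro ⟨a, ha, hax⟩
    by_cases haS : a ∈ S
    · rw [if_pos haS] at hax; exact absurd hax Sum.inr_ne_inl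
    · rw [if_neg haS] at hax
      have := Sum.inl.inj hax
      subst this
      exact ⟨ha, haS⟩
  · rintro ⟨hx, hxS⟩
    exact ⟨x, hx, by rw [if_neg hxS]⟩

omit [Fintype E] [DecidableEq E] in
/-- `inr e'` is an endpoint of the split edge `e` iff `e' = e` has an endpoint in `S`. -/
lemma inr_mem_splitEndsS_iff {e e' : E} :
    Sum.inr e' ∈ splitEndsS ends S e ↔ e' = e ∧ ∃ u ∈ S, u ∈ ends e := by
  simp only [splitEndsS, Sym2.mem_map]
  constructor
  · rintro ⟨a, ha, hae⟩
    by_cases haS : a ∈ S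
    · rw [if_pos haS] at hae
      exact ⟨(Sum.inr.inj hae).symm, a, haS, ha⟩
    · rw [if_neg haS] at hae; exact absurd hae Sum.inl_ne_inr
  · rintro ⟨rfl, u, huS, hu⟩
    exact ⟨u, hu, by rw [if_pos huS]⟩

omit [Fintype E] [DecidableEq E] in
/-- The split edge of an edge with no endpoint in `S`. -/
lemma splitEndsS_of_notMem {e : E} {x y : V} (hxy : ends e = s(x, y)) (hx : x ∉ S) (hy : y ∉ S) :
    splitEndsS ends S e = s(Sum.inl x, Sum.inl y) := by
  simp only [splitEndsS, hxy, Sym2.map_mk, if_neg hx, if_neg hy]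

omit [Fintype E] [DecidableEq E] in
/-- The split edge of an edge `s(u, p)` with `u ∈ S`, `p ∉ S`. -/
lemma splitEndsS_of_mem {e : E} {u p : V} (hup : ends e = s(u, p)) (hu : u ∈ S) (hp : p ∉ S) :
    splitEndsS ends S e = s(Sum.inr e, Sum.inl p) := by
  simp only [splitEndsS, hup, Sym2.map_mk, if_pos hu, if_neg hp]

omit [Fintype E] [DecidableEq E] in
/-- For an independent `S`, the other end of an edge at `u ∈ S` is not in `S`. -/
lemma other_notMem_of_indep (hind : IndepSet ends S) {e : E} {u : V} (hu : u ∈ S)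
    (he : u ∈ ends e) : Sym2.Mem.other he ∉ S := fun h' =>
  hind e u hu _ h' (Sym2.other_spec he).symm

omit [Fintype E] [DecidableEq E] in
/-- `ends e = s(u, other)` for an edge at `u`. -/
lemma ends_eq_otherS {e : E} {u : V} (he : u ∈ ends e) : ends e = s(u, Sym2.Mem.other he) :=
  (Sym2.other_spec he).symm

omit [Fintype E] [DecidableEq E] in
/-- The other end of an edge `s(u, p)` at `u` is `p` (when `p ≠ u`). -/
lemma other_eq_of_endsS {e : E} {u : V} (he : u ∈ ends e) {p : V} (hp : ends e = s(u, p))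
    (hpu : p ≠ u) : Sym2.Mem.other he = p := by
  have h1 : s(u, Sym2.Mem.other he) = s(u, p) := (Sym2.other_spec he).trans hp
  rw [Sym2.eq_iff] at h1
  rcases h1 with ⟨_, h⟩ | ⟨h, _⟩
  · exact h
  · exact absurd h.symm hpu

omit [Fintype E] [DecidableEq E] in
/-- Every element of `Sym2` is a pair. -/
lemma exists_pairS (z : Sym2 V) : ∃ x y : V, z = s(x, y) :=
  Sym2.ind (fun x y => ⟨x, y, rfl⟩) z

omit [Fintype E] [DecidableEq E] in
/-- The split edge of an edge at `u ∈ S` (independent `S`). -/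
lemma splitEndsS_of_mem' (hind : IndepSet ends S) {e : E} {u : V} (hu : u ∈ S)
    (he : u ∈ ends e) :
    splitEndsS ends S e = s(Sum.inr e, Sum.inl (Sym2.Mem.other he)) :=
  splitEndsS_of_mem (ends_eq_otherS he) hu (other_notMem_of_indep hind hu he)

omit [Fintype E] [DecidableEq E] in
/-- Two vertices of an independent `S` on one edge coincide. -/
lemma eq_of_two_mem_indep (hind : IndepSet ends S) {e : E} {u u' : V} (hu : u ∈ S) (hu' : u' ∈ S)
    (he : u ∈ ends e) (he' : u' ∈ ends e) : u' = u := by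
  by_contra huu
  have h1 := ends_eq_otherS he
  have h2 : u' ∈ s(u, Sym2.Mem.other he) := by rw [← h1]; exact he'
  rw [Sym2.mem_iff] at h2
  rcases h2 with h2 | h2
  · exact huu h2
  · exact hind e u hu u' hu' (by rw [h1, h2])

omit [Fintype E] [DecidableEq E] in
/-- A vertex of `S` carries no split edge. -/
lemma inl_mem_S_not_mem_splitEndsS {u : V} (hu : u ∈ S) (e : E) :
    Sum.inl u ∉ splitEndsS ends S e := fun h' => (inl_mem_splitEndsS_iff.1 h').2 hu

/-! ## Connectivity transfer -/

variable {ω : Config E} {a : V}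

omit [Fintype E] [DecidableEq E] in
/-- **From the split graph to the graph** (independent `S`): an `inl`-vertex connected to `inl a`
is connected to `a`; a copy `inr e` connected to `inl a` is the copy of a red edge at `S` whose
other end is connected to `a`. -/
theorem cluster_splitS_subset (hind : IndepSet ends S) :
    cluster (splitEndsS ends S) ω (Sum.inl a) ⊆
      {v' | Sum.elim (fun x => Conn ends ω a x)
        (fun e => ∃ u ∈ S, ∃ h : u ∈ ends e, ω e = true ∧ Conn ends ω a (Sym2.Mem.other h)) v'} := by
  intro v' hv'
  refine mem_of_conn_of_closed (ends := splitEndsS ends S) (ω := ω) ?_ (conn_refl ends ω a) hv'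
  intro x' hx' y' hxy
  obtain ⟨hne, e, he, hends⟩ := openGraph_adj.1 hxy
  by_cases hu : ∃ u ∈ S, u ∈ ends e
  · obtain ⟨u, huS, hue⟩ := hu
    rw [splitEndsS_of_mem' hind huS hue, Sym2.eq_iff] at hends
    rcases hends with ⟨rfl, rfl⟩ | ⟨rfl, rfl⟩
    · obtain ⟨u', hu'S, h', _, hc⟩ := hx'
      have huu : u' = u := eq_of_two_mem_indep hind huS hu'S hue h'
      subst huu
      exact hc
    · exact ⟨u, huS, hue, he, hx'⟩
  · push Not at hu
    obtain ⟨p, q, hpq⟩ := exists_pairS (ends e)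
    have hp : p ∉ S := fun h' => hu p h' (by rw [hpq]; exact Sym2.mem_mk_left p q)
    have hq : q ∉ S := fun h' => hu q h' (by rw [hpq]; exact Sym2.mem_mk_right p q)
    rw [splitEndsS_of_notMem hpq hp hq, Sym2.eq_iff] at hends
    rcases hends with ⟨rfl, rfl⟩ | ⟨rfl, rfl⟩
    · exact mem_cluster_of_edge (v := a) hx' he hpq
    · exact mem_cluster_of_edge (v := a) hx' he (ends_swap hpq)

omit [Fintype E] [DecidableEq E] in
/-- `inl b` connected to `inl a` in the split graph gives `b` connected to `a`. -/
theorem conn_of_conn_splitS_inl (hind : IndepSet ends S) {b : V}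
    (h : Conn (splitEndsS ends S) ω (Sum.inl a) (Sum.inl b)) : Conn ends ω a b :=
  cluster_splitS_subset hind h

omit [Fintype E] [DecidableEq E] in
/-- A copy `inr e` connected to `inl a` in the split graph: `e` is a red edge at `S` whose other
end is connected to `a`. -/
theorem conn_of_conn_splitS_inr (hind : IndepSet ends S) {e : E}
    (h : Conn (splitEndsS ends S) ω (Sum.inl a) (Sum.inr e)) :
    ∃ u ∈ S, ∃ hu : u ∈ ends e, ω e = true ∧ Conn ends ω a (Sym2.Mem.other hu) :=
  cluster_splitS_subset hind h

omit [Fintype E] [DecidableEq E] in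
/-- **From the graph to the split graph**, away from `S`: if no vertex of `S` is in `C(a)` then
everything connected to `a` is connected to `inl a` in the split graph. -/
theorem conn_splitS_of_conn (hind : IndepSet ends S) (hS : ∀ u ∈ S, u ∉ cluster ends ω a) {b : V}
    (hab : Conn ends ω a b) : Conn (splitEndsS ends S) ω (Sum.inl a) (Sum.inl b) := by
  refine mem_of_conn_of_closed (ends := ends) (ω := ω)
    (S := {x | Conn (splitEndsS ends S) ω (Sum.inl a) (Sum.inl x)}) ?_ (conn_refl _ _ _) hab
  intro x hx y hxy
  obtain ⟨hne, e, he, hends⟩ := openGraph_adj.1 hxy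
  have hxa : x ∈ cluster ends ω a := conn_of_conn_splitS_inl hind hx
  have hya : y ∈ cluster ends ω a := mem_cluster_of_edge hxa he hends
  have hxS : x ∉ S := fun h' => hS x h' hxa
  have hyS : y ∉ S := fun h' => hS y h' hya
  exact mem_cluster_of_edge (v := Sum.inl a) hx he (splitEndsS_of_notMem hends hxS hyS)

omit [Fintype E] [DecidableEq E] in
/-- A copy `inr e` (edge `e` at `u ∈ S`) lies in the split cluster of `inl a` iff `e` is red and
its other end's copy does (independent `S`). -/
theorem inr_mem_cluster_splitS_iff (hind : IndepSet ends S) {e : E} {u : V} (hu : u ∈ S)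
    (he : u ∈ ends e) :
    Sum.inr e ∈ cluster (splitEndsS ends S) ω (Sum.inl a) ↔
      ω e = true ∧ Sum.inl (Sym2.Mem.other he) ∈ cluster (splitEndsS ends S) ω (Sum.inl a) := by
  constructor
  · intro h
    have key : cluster (splitEndsS ends S) ω (Sum.inl a) ⊆
        {v' | v' ∈ cluster (splitEndsS ends S) ω (Sum.inl a) ∧ (v' ≠ Sum.inr e ∨
          (ω e = true ∧ Sum.inl (Sym2.Mem.other he) ∈
            cluster (splitEndsS ends S) ω (Sum.inl a)))} := by
      intro v' hv'
      refine mem_of_conn_of_closed (ends := splitEndsS ends S) (ω := ω) ?_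
        ⟨mem_cluster_self _ _ _, Or.inl Sum.inl_ne_inr⟩ hv'
      intro x' hx' y' hxy
      obtain ⟨hne, e', he', hends⟩ := openGraph_adj.1 hxy
      refine ⟨mem_cluster_of_adj hx'.1 hxy, ?_⟩
      by_cases hy : y' = Sum.inr e
      · subst hy
        have h1 : Sum.inr e ∈ splitEndsS ends S e' := by
          rw [hends]; exact Sym2.mem_mk_right _ _
        obtain ⟨rfl, _⟩ := inr_mem_splitEndsS_iff.1 h1
        rw [splitEndsS_of_mem' hind hu he, Sym2.eq_iff] at hends
        rcases hends with ⟨h2, _⟩ | ⟨_, h2⟩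
        · exact absurd h2.symm hne
        · exact Or.inr ⟨he', by rw [h2]; exact hx'.1⟩
      · exact Or.inl hy
    rcases (key h).2 with h' | h'
    · exact absurd rfl h'
    · exact h'
  · rintro ⟨he', hc⟩
    exact mem_cluster_of_edge (v := Sum.inl a) hc he'
      (ends_swap (splitEndsS_of_mem' hind hu he))

omit [Fintype E] [DecidableEq E] in
/-- A vertex of `S` is in no split cluster but its own. -/
lemma inl_S_notMem_cluster_splitS {u : V} (hu : u ∈ S) (hau : a ≠ u) :
    Sum.inl u ∉ cluster (splitEndsS ends S) ω (Sum.inl a) := by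
  intro hmem
  have key : cluster (splitEndsS ends S) ω (Sum.inl a) ⊆ {v' | v' ≠ Sum.inl u} := by
    intro v' hv'
    refine mem_of_conn_of_closed (ends := splitEndsS ends S) (ω := ω) ?_
      (fun h' => hau (Sum.inl.inj h')) hv'
    intro x' _ y' hxy
    obtain ⟨_, e, _, hends⟩ := openGraph_adj.1 hxy
    intro hy
    subst hy
    exact inl_mem_S_not_mem_splitEndsS hu e (by rw [hends]; exact Sym2.mem_mk_right _ _)
  exact key hmem rfl

end SplitS

end LocRows

end Summit.Ventures.PercRepro2
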